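import Summits.BirchSwinnertonDyer.BirchSwinnertonDyer.Theorems.AdditiveKolyvaginRoadEigen
import Summits.BirchSwinnertonDyer.BirchSwinnertonDyer.Theorems.KolyvaginRoadThreeMethod2ChebOfMcCallum
import Literature.NumberTheory.EllipticCurves.ZywinaCMImageProofs
import HarnessLib

/-!
# Route `AdditiveKolyvaginRoad`, crux `KolyvaginPrimitiveAdditive` (item stmt-BirchSwinnertonDyer-20132):
# (Cheb1) and (Cheb2) of W. Zhang's induction FROM McCALLUM'S COR. 3.2, at a general odd prime `p`
# (cell `pub/bsd-wall`, lead prover `bsd-wall-akr-p1` g3; `--supports stmt-BirchSwinnertonDyer-20132`, helper;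
# p-generic port of zhang3-p1's `Theorems/KolyvaginRoadThreeMethod2ChebOfMcCallum.lean`)

WHY THIS FILE. Two of the engine-currency inputs of S2-ENGINE (`inductionOfLevelSystemsP_of_engineInputs`, p528422)
are the Čebotarev supplies (Cheb1) «every non-zero class of `H¹(K, E[p])` is non-zero at the place of some Kolyvagin
prime outside any finite set» and (Cheb2) «two non-zero classes of opposite signs are simultaneously non-zero at some
Kolyvagin prime outside any finite set» [W. Zhang 2014 Lemma 8.1 = McCallum 1991 Cor. 3.2 for eigenclasses]. The
tree PROVES McCallum's Cor. 3.2 for eigenclasses at EVERY odd prime with `ρ̄_{E,p}` onto and no CM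
(`McCallum1991_cor_3_2_eigen_holds`, from Čebotarev for Artin representations and the Weil pairing), so both inputs are
kernel theorems at an additive `p ≥ 5` too: `¬CM` follows from `ρ̄` onto at an odd prime (Zywina,
`WeierstrassCurve.not_hasSurjectiveModNGaloisRep_of_hasCM`) — at `p = 3` zhang3-p1 used the multiplicative prime.

WHAT.
* §1 arithmetic in the `𝔽_p`-space `H¹(K, E[p])` for odd `p`: `eq_zero_of_zsmul_eq_zero_of_not_dvd_P`,
  `dvd_of_zsmul_eq_zero_P`, independence of opposite eigenclasses `dvd_and_dvd_of_zsmul_add_zsmul_eq_zero_P`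
  (via `(2u) • x = x`, akr-p1 g2's `exists_two_mul_zsmul_eq_of_odd`);
* §2 `zhang_isKolyvaginPrime_of_gross_P` — a Kolyvagin prime in Gross's sense at level `p` is one in Zhang's sense;
  `exists_zhangKolyvaginPrime_notMem_of_eigenP` — McCallum's Cor. 3.2 read for the engine;
* §3 `chebOne_of_mcCallum_P`, `chebTwo_of_mcCallum_P` — (Cheb1), (Cheb2) over any apparatus whose finite-place
  localisations satisfy the strict-vanishing dictionary `x ∈ torsionLocalKer_v ↔ loc_v x = 0`.

HONEST FRAMING: theorems only; 0 definitions, 0 named facts, 0 `sorry`; closes nothing.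

References: [cite: WZhang2014, Lemma 8.1] [cite: McCallumLMS1991, §3 Prop. 3.1, Cor. 3.2] [cite: GrossLMS1991, §3
(3.2)–(3.3), §9] [cite: Zywina2015, Prop. 1.14].
-/

-- single-conjunct summit: `Summit.BirchSwinnertonDyer.BirchSwinnertonDyer.…` repeats the name by design
set_option linter.dupNamespace false

noncomputable section

open scoped Classical

namespace Summit.BirchSwinnertonDyer.BirchSwinnertonDyer.Theorems.AdditiveKoly

open WeierstrassCurve NumberField IsDedekindDomain
  Literature.NumberTheory.EllipticCurves Literature.NumberTheory.EllipticCurves.ModularForms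
  Literature.NumberTheory.GaloisRepresentations Module
open Summit.BirchSwinnertonDyer.Rank1Residual.X11b.Three.Koly.Method2

variable (W : WeierstrassCurve ℚ) (K : Type) [Field K] [NumberField K] (p : ℕ) [Fact p.Prime]

/-! ## §1 Arithmetic in the `𝔽_p`-space `H¹(K, E[p])`, `p` odd -/

/-- An integer multiple `a • x` with `p ∤ a` vanishes only if `x = 0` (`p • x = 0`, Bezout). [folklore] -/
theorem eq_zero_of_zsmul_eq_zero_of_not_dvd_P {a : ℤ} (ha : ¬ (p : ℤ) ∣ a) {x : Vp W K p} (h : a • x = 0) :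
    x = 0 := by
  have hp : p.Prime := Fact.out
  have hcop : IsCoprime (p : ℤ) a := (Nat.prime_iff_prime_int.mp hp).irreducible.coprime_iff_not_dvd.mpr ha
  obtain ⟨u, v, huv⟩ := hcop
  calc x = (u * p + v * a) • x := by rw [huv, one_zsmul]
    _ = u • ((p : ℤ) • x) + v • (a • x) := by rw [add_zsmul, mul_zsmul, mul_zsmul]
    _ = 0 := by rw [h, prime_smul_eq_zero W K p x, zsmul_zero, zsmul_zero, add_zero]

/-- `p ∣ a` whenever `a • x = 0` for a NON-ZERO class `x`. [folklore] -/
theorem dvd_of_zsmul_eq_zero_P {a : ℤ} {x : Vp W K p} (hx : x ≠ 0) (h : a • x = 0) : (p : ℤ) ∣ a := by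
  by_contra ha
  exact hx (eq_zero_of_zsmul_eq_zero_of_not_dvd_P W K p ha h)

/-- **Independence of two non-zero classes of opposite signs** (for an additive map `τ` acting by `e` and `−e`,
`e = ±1`), `p` odd: `a • x + b • y = 0 ⟹ p ∣ a ∧ p ∣ b`. Apply `τ`, subtract ∕ add, and use that `2` is invertible on
`H¹(K, E[p])` (`(2u) • z = z`). [cite: McCallumLMS1991, §3 (independent classes)] -/
theorem dvd_and_dvd_of_zsmul_add_zsmul_eq_zero_P (hp2 : p ≠ 2) (τ : Vp W K p →+ Vp W K p) {e : ℤ}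
    (he : e = 1 ∨ e = -1) {x y : Vp W K p} (hx : τ x = e • x) (hy : τ y = (-e) • y) (hx0 : x ≠ 0) (hy0 : y ≠ 0)
    {a b : ℤ} (h : a • x + b • y = 0) : (p : ℤ) ∣ a ∧ (p : ℤ) ∣ b := by
  have hp : p.Prime := Fact.out
  obtain ⟨u, hu⟩ := exists_two_mul_zsmul_eq_of_odd W K p (hp.odd_of_ne_two hp2)
  have hτ : e • (a • x - b • y) = 0 := by
    have h' := congrArg τ h
    rw [map_add, map_zsmul, map_zsmul, hx, hy, map_zero, smul_comm a e x, smul_comm b (-e) y, neg_zsmul,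
      ← sub_eq_add_neg, ← zsmul_sub] at h'
    exact h'
  have hdiff : a • x - b • y = 0 := by
    rcases he with rfl | rfl
    · rwa [one_zsmul] at hτ
    · rwa [neg_one_zsmul, neg_eq_zero] at hτ
  have ha : (2 : ℤ) • (a • x) = 0 := by
    rw [two_zsmul]
    calc a • x + a • x = (a • x + b • y) + (a • x - b • y) := by abel
      _ = 0 := by rw [h, hdiff, add_zero]
  have hb : (2 : ℤ) • (b • y) = 0 := by
    rw [two_zsmul]
    calc b • y + b • y = (a • x + b • y) - (a • x - b • y) := by abel
      _ = 0 := by rw [h, hdiff, sub_zero]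
  -- `2` is invertible: `z = (2u) • z = u • (2 • z)`
  have h2 : ∀ z : Vp W K p, (2 : ℤ) • z = 0 → z = 0 := fun z hz ↦ by
    rw [← hu z, mul_comm, mul_zsmul, hz, zsmul_zero]
  exact ⟨dvd_of_zsmul_eq_zero_P W K p hx0 (h2 _ ha), dvd_of_zsmul_eq_zero_P W K p hy0 (h2 _ hb)⟩

/-! ## §2 Gross's Kolyvagin primes at level `p` are Zhang's; McCallum's Cor. 3.2 read for the engine -/

variable [W.IsElliptic] [W.IsGloballyMinimal]

omit [Fact p.Prime] in
/-- A Kolyvagin prime in Gross's sense at level `p = p¹` (`Frob(ℓ) = Frob(∞)` on `K(E[p])`) is a Kolyvagin prime in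
Zhang's sense (index `M(ℓ) ≥ 1`: `p ∣ ℓ + 1`, `p ∣ a_ℓ`). [cite: GrossLMS1991, §3 (3.2)–(3.3)]
[cite: WZhang2014, Notations (xii)] -/
theorem zhang_isKolyvaginPrime_of_gross_P (hp : p.Prime) {ℓ : ℕ}
    (hℓ : IsKolyvaginPrime (W.conductorNorm ℤ) W K (p ^ 1) ℓ) :
    Zhang2014.IsKolyvaginPrime (W.conductorNorm ℤ) W K p ℓ := by
  obtain ⟨hP, hN, hD, hℓp, hprime, hfrob⟩ := hℓ
  have hℓp' : ℓ ≠ p := by simpa using hℓp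
  have hidx : 1 ≤ Zhang2014.kolyvaginIndex W p ℓ :=
    McCallum1991.le_kolyvaginIndex_of_frobEqFrobInfty W K hp (M := 1) le_rfl hP hℓp' hN hfrob
  exact ⟨hP, hN, hD, hℓp', hprime, hidx⟩

variable [NeZero (W.conductorNorm ℤ)] (c : K ≃ₐ[ℚ] K)

/-- **McCallum's Cor. 3.2 at a general odd `p`, read for the S2 engine**: for `r` eigenclasses `cs` (`τ cs i = ± cs i`),
independent (`∑ aᵢ csᵢ = 0 ⟹ p ∣ aᵢ`), and exponents `Nv i ≤ 1`, and any finite set `T` of Zhang–Kolyvagin primes,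
there is a Zhang–Kolyvagin prime `ℓ ∉ T` at whose place `cs i` is STRICT iff `Nv i = 0`. Frame: `K` imaginary
quadratic, `c ≠ 1`, `p` odd, `ρ̄_{E,p}` onto (hence no CM, Zywina). [cite: McCallumLMS1991, §3 Cor. 3.2]
[cite: Zywina2015, Prop. 1.14] -/
theorem exists_zhangKolyvaginPrime_notMem_of_eigenP (hK : IsImaginaryQuadratic K) (hp2 : p ≠ 2)
    (hsurj : W.HasSurjectiveModNGaloisRep p) (hc : c ≠ 1)
    {r : ℕ} (cs : Fin r → Vp W K p)
    (hτ : ∀ i, ∃ e : ℤ, (e = 1 ∨ e = -1) ∧ conjAct W c ((p ^ 1 : ℕ) : ℤ) (cs i) = e • cs i)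
    (Nv : Fin r → ℕ) (hN : ∀ i, Nv i ≤ 1) (hind : ∀ a : Fin r → ℤ, ∑ i, a i • cs i = 0 → ∀ i, (p : ℤ) ∣ a i)
    (T : Finset {ℓ // Zhang2014.IsKolyvaginPrime (W.conductorNorm ℤ) W K p ℓ}) :
    ∃ ℓ : {ℓ // Zhang2014.IsKolyvaginPrime (W.conductorNorm ℤ) W K p ℓ}, ℓ ∉ T ∧
      ∀ i, ∀ v : HeightOneSpectrum (𝓞 K), ((ℓ : ℕ) : 𝓞 K) ∈ v.asIdeal →
        (cs i ∈ (W.baseChange K).torsionLocalKer (v.adicCompletion K) ((p ^ 1 : ℕ) : ℤ) ↔ Nv i = 0) := by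
  have hp : p.Prime := Fact.out
  have hCM : ¬ W.HasCM := fun hCM ↦ W.not_hasSurjectiveModNGaloisRep_of_hasCM hCM hp (by omega) hsurj
  have hp1 : Nat.Prime (p ^ 1) := by simpa using hp
  have hp12 : (p ^ 1) ≠ 2 := by simpa using hp2
  have hρ : W.HasSurjectiveModNGaloisRep (p ^ 1) := by simpa using hsurj
  have hinf := McCallum1991_cor_3_2_eigen_holds (W.conductorNorm ℤ) W K hCM hK hp1 hp12 hρ c hc r cs hτ Nv hN
    (fun a ha i ↦ by simpa using hind a ha i)
  -- infinitely many Gross–Kolyvagin primes; pick one outside the (finitely many) primes of T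
  obtain ⟨ℓ, hℓmem, hℓT⟩ := hinf.exists_notMem_finset (T.image Subtype.val)
  obtain ⟨hℓK, hℓloc⟩ := hℓmem
  refine ⟨⟨ℓ, zhang_isKolyvaginPrime_of_gross_P W K p hp hℓK⟩, fun h ↦ hℓT (Finset.mem_image.mpr ⟨_, h, rfl⟩), ?_⟩
  intro i v hv
  exact hℓloc i v hv

/-! ## §3 (Cheb1) and (Cheb2) -/

variable [Module (ZMod p) (Vp W K p)]

/-- **(Cheb1) for the S2 engine at a general odd `p`, PROVED**: over any apparatus with `ZMod p`-linear localisations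
`loc (Sum.inr v)` at the finite places satisfying the strict-vanishing dictionary `x ∈ torsionLocalKer_v ↔ loc_v x = 0`,
every non-zero class of `H¹(K, E[p])` has non-zero localisation at the place of some Zhang–Kolyvagin prime outside
any finite set. Proof: split `x = (2u)x = u(x⁺ + x⁻)` into `τ`-eigen-components; McCallum Cor. 3.2 for the non-zero
ones with exponent pattern `(1, 0)`. [cite: WZhang2014, Lemma 8.1] [cite: McCallumLMS1991, Cor. 3.2] -/
theorem chebOne_of_mcCallum_P (hK : IsImaginaryQuadratic K) (hp2 : p ≠ 2)
    (hsurj : W.HasSurjectiveModNGaloisRep p) (hc : c ≠ 1)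
    {Hv : Place K → Type} [∀ v, AddCommGroup (Hv v)] [∀ v, Module (ZMod p) (Hv v)]
    (loc : (v : Place K) → Vp W K p →ₗ[ZMod p] Hv v)
    (plK : {ℓ // Zhang2014.IsKolyvaginPrime (W.conductorNorm ℤ) W K p ℓ} → HeightOneSpectrum (𝓞 K))
    (hplK : ∀ ℓ, ((ℓ : ℕ) : 𝓞 K) ∈ (plK ℓ).asIdeal)
    (hZero : ∀ (v : HeightOneSpectrum (𝓞 K)) (x : Vp W K p),
      x ∈ (W.baseChange K).torsionLocalKer (v.adicCompletion K) ((p ^ 1 : ℕ) : ℤ) ↔ loc (Sum.inr v) x = 0) :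
    ∀ x : Vp W K p, x ≠ 0 → ∀ T : Finset {ℓ // Zhang2014.IsKolyvaginPrime (W.conductorNorm ℤ) W K p ℓ},
      ∃ ℓ, ℓ ∉ T ∧ loc (Sum.inr (plK ℓ)) x ≠ 0 := by
  intro x hx0 T
  have hp : p.Prime := Fact.out
  have hcc : c * c = 1 := algEquiv_mul_self_eq_one K hK c
  have hττ : ∀ z, conjAct W c ((p ^ 1 : ℕ) : ℤ) (conjAct W c ((p ^ 1 : ℕ) : ℤ) z) = z :=
    conjAct_conjAct_of_mul_self W hcc ((p ^ 1 : ℕ) : ℤ)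
  obtain ⟨u, hu⟩ := exists_two_mul_zsmul_eq_of_odd W K p (hp.odd_of_ne_two hp2)
  -- eigen-components: u⁺ = x + τx (sign +1), w = x − τx (sign −1), x = u • (u⁺ + w)
  set y := x + conjAct W c ((p ^ 1 : ℕ) : ℤ) x with hy
  set w := x - conjAct W c ((p ^ 1 : ℕ) : ℤ) x with hw
  have hτy : conjAct W c ((p ^ 1 : ℕ) : ℤ) y = (1 : ℤ) • y := by
    rw [hy, map_add, hττ, one_zsmul, add_comm]
  have hτw : conjAct W c ((p ^ 1 : ℕ) : ℤ) w = (-1 : ℤ) • w := by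
    rw [hw, map_sub, hττ, neg_one_zsmul, neg_sub]
  have hx2 : x = u • (y + w) := by
    have hyw : y + w = (2 : ℤ) • x := by rw [hy, hw, two_zsmul]; abel
    rw [hyw, ← mul_zsmul, mul_comm, hu]
  have hlocx : ∀ v : Place K, loc v x = u • (loc v y + loc v w) := fun v ↦ by
    rw [hx2, map_zsmul, map_add]
  -- `loc_v z = 0` as soon as `loc_v x = u • loc_v z` and `loc_v x = 0` (`z = (2u) • z`, `loc` additive)
  have hkey : ∀ (v : Place K) (z : Vp W K p), loc v x = u • loc v z → loc v x = 0 → loc v z = 0 := by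
    intro v z hxz hx
    calc loc v z = loc v ((2 * u) • z) := by rw [hu z]
      _ = (2 : ℤ) • (u • loc v z) := by rw [map_zsmul, mul_zsmul]
      _ = 0 := by rw [← hxz, hx, zsmul_zero]
  have hτy' : ∃ e : ℤ, (e = 1 ∨ e = -1) ∧ conjAct W c ((p ^ 1 : ℕ) : ℤ) y = e • y := ⟨1, Or.inl rfl, hτy⟩
  have hτw' : ∃ e : ℤ, (e = 1 ∨ e = -1) ∧ conjAct W c ((p ^ 1 : ℕ) : ℤ) w = e • w := ⟨-1, Or.inr rfl, hτw⟩
  -- independence of a single non-zero class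
  have hind1 : ∀ {z : Vp W K p}, z ≠ 0 → ∀ a : Fin 1 → ℤ, ∑ i, a i • (![z] i) = 0 → ∀ i, (p : ℤ) ∣ a i := by
    intro z hz a ha i
    fin_cases i
    simp only [Fin.sum_univ_one, Matrix.cons_val_zero] at ha
    exact dvd_of_zsmul_eq_zero_P W K p hz ha
  by_cases hy0 : y = 0
  · -- then w ≠ 0 and x = u • w: McCallum for (w), exponent 1
    have hw0 : w ≠ 0 := fun h ↦ hx0 (by rw [hx2, hy0, h, add_zero, zsmul_zero])
    obtain ⟨ℓ, hℓT, hℓ⟩ := exists_zhangKolyvaginPrime_notMem_of_eigenP W K p c hK hp2 hsurj hc ![w]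
      (fun i ↦ by fin_cases i; exact hτw') ![1] (fun i ↦ by fin_cases i; simp) (hind1 hw0) T
    refine ⟨ℓ, hℓT, fun h0 ↦ ?_⟩
    have hwloc : loc (Sum.inr (plK ℓ)) w ≠ 0 := fun h ↦ by
      have := (hℓ 0 (plK ℓ) (hplK ℓ)).mp ((hZero _ _).mpr h)
      simp at this
    have := hlocx (Sum.inr (plK ℓ))
    rw [hy0, map_zero, zero_add] at this
    exact hwloc (hkey _ w this h0)
  · by_cases hw0 : w = 0
    · -- x = u • y: McCallum for (y), exponent 1
      obtain ⟨ℓ, hℓT, hℓ⟩ := exists_zhangKolyvaginPrime_notMem_of_eigenP W K p c hK hp2 hsurj hc ![y]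
        (fun i ↦ by fin_cases i; exact hτy') ![1] (fun i ↦ by fin_cases i; simp) (hind1 hy0) T
      refine ⟨ℓ, hℓT, fun h0 ↦ ?_⟩
      have hyloc : loc (Sum.inr (plK ℓ)) y ≠ 0 := fun h ↦ by
        have := (hℓ 0 (plK ℓ) (hplK ℓ)).mp ((hZero _ _).mpr h)
        simp at this
      have := hlocx (Sum.inr (plK ℓ))
      rw [hw0, map_zero, add_zero] at this
      exact hyloc (hkey _ y this h0)
    · -- both non-zero: McCallum for (y, w), exponents (1, 0): loc y ≠ 0 and loc w = 0
      obtain ⟨ℓ, hℓT, hℓ⟩ := exists_zhangKolyvaginPrime_notMem_of_eigenP W K p c hK hp2 hsurj hc ![y, w]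
        (fun i ↦ by
          fin_cases i
          · exact hτy'
          · exact hτw')
        ![1, 0] (fun i ↦ by fin_cases i <;> simp)
        (fun a ha ↦ by
          simp only [Fin.sum_univ_two, Matrix.cons_val_zero, Matrix.cons_val_one] at ha
          have h := dvd_and_dvd_of_zsmul_add_zsmul_eq_zero_P W K p hp2 (conjAct W c ((p ^ 1 : ℕ) : ℤ)) (e := 1)
            (Or.inl rfl) hτy hτw hy0 hw0 ha
          intro i
          fin_cases i
          · exact h.1
          · exact h.2) T
      refine ⟨ℓ, hℓT, fun h0 ↦ ?_⟩
      have hyloc : loc (Sum.inr (plK ℓ)) y ≠ 0 := fun h ↦ by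
        have := (hℓ 0 (plK ℓ) (hplK ℓ)).mp ((hZero _ _).mpr h)
        simp at this
      have hwloc : loc (Sum.inr (plK ℓ)) w = 0 := by
        have := (hℓ 1 (plK ℓ) (hplK ℓ)).mpr (by simp)
        exact (hZero _ _).mp this
      have := hlocx (Sum.inr (plK ℓ))
      rw [hwloc, add_zero] at this
      exact hyloc (hkey _ y this h0)

/-- **(Cheb2) for the S2 engine at a general odd `p`, PROVED**: two non-zero classes of OPPOSITE signs (eigenspaces
`E s`, `E (¬s)` of complex conjugation, dictionary `hE`) are simultaneously non-zero at the place of some Zhang–Kolyvagin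
prime outside any finite set — McCallum Cor. 3.2 with exponent pattern `(1, 1)` (independence of opposite
eigenclasses). [cite: WZhang2014, Lemma 8.1] [cite: McCallumLMS1991, Prop. 3.1, Cor. 3.2] -/
theorem chebTwo_of_mcCallum_P (hK : IsImaginaryQuadratic K) (hp2 : p ≠ 2)
    (hsurj : W.HasSurjectiveModNGaloisRep p) (hc : c ≠ 1)
    {Hv : Place K → Type} [∀ v, AddCommGroup (Hv v)] [∀ v, Module (ZMod p) (Hv v)]
    (loc : (v : Place K) → Vp W K p →ₗ[ZMod p] Hv v) (E : Bool → Submodule (ZMod p) (Vp W K p))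
    (plK : {ℓ // Zhang2014.IsKolyvaginPrime (W.conductorNorm ℤ) W K p ℓ} → HeightOneSpectrum (𝓞 K))
    (hplK : ∀ ℓ, ((ℓ : ℕ) : 𝓞 K) ∈ (plK ℓ).asIdeal)
    (hE : ∀ (s : Bool) (x : Vp W K p), x ∈ E s ↔ conjAct W c ((p ^ 1 : ℕ) : ℤ) x = sgnP s • x)
    (hZero : ∀ (v : HeightOneSpectrum (𝓞 K)) (x : Vp W K p),
      x ∈ (W.baseChange K).torsionLocalKer (v.adicCompletion K) ((p ^ 1 : ℕ) : ℤ) ↔ loc (Sum.inr v) x = 0) :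
    ∀ (s : Bool), ∀ x ∈ E s, ∀ y ∈ E (!s), x ≠ 0 → y ≠ 0 →
      ∀ T : Finset {ℓ // Zhang2014.IsKolyvaginPrime (W.conductorNorm ℤ) W K p ℓ},
      ∃ ℓ, ℓ ∉ T ∧ loc (Sum.inr (plK ℓ)) x ≠ 0 ∧ loc (Sum.inr (plK ℓ)) y ≠ 0 := by
  intro s x hx y hy hx0 hy0 T
  have hxτ := (hE s x).mp hx
  have hyτ := (hE (!s) y).mp hy
  have hsgn : sgnP (!s) = -sgnP s := by cases s <;> rfl
  have hes : sgnP s = 1 ∨ sgnP s = -1 := by cases s <;> simp [sgnP]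
  rw [hsgn] at hyτ
  obtain ⟨ℓ, hℓT, hℓ⟩ := exists_zhangKolyvaginPrime_notMem_of_eigenP W K p c hK hp2 hsurj hc ![x, y]
    (fun i ↦ by
      fin_cases i
      · exact ⟨sgnP s, hes, hxτ⟩
      · refine ⟨-sgnP s, ?_, hyτ⟩
        rcases hes with h | h <;> simp [h])
    ![1, 1] (fun i ↦ by fin_cases i <;> simp)
    (fun a ha ↦ by
      simp only [Fin.sum_univ_two, Matrix.cons_val_zero, Matrix.cons_val_one] at ha
      have h := dvd_and_dvd_of_zsmul_add_zsmul_eq_zero_P W K p hp2 (conjAct W c ((p ^ 1 : ℕ) : ℤ)) hes hxτ hyτ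
        hx0 hy0 ha
      intro i
      fin_cases i
      · exact h.1
      · exact h.2) T
  refine ⟨ℓ, hℓT, fun h0 ↦ ?_, fun h0 ↦ ?_⟩
  · have := (hℓ 0 (plK ℓ) (hplK ℓ)).mp ((hZero _ _).mpr h0)
    simp at this
  · have := (hℓ 1 (plK ℓ) (hplK ℓ)).mp ((hZero _ _).mpr h0)
    simp at this

end Summit.BirchSwinnertonDyer.BirchSwinnertonDyer.Theorems.AdditiveKoly

end
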